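import Summits.CriticalPhenomena.PercolationContinuityZ3.Theorems.PercNearOneGluingNoHeavyLowerTailSahiE3DimerOver
import Summits.CriticalPhenomena.PercolationContinuityZ3.Theorems.PercNearOneGluingNoHeavyLowerTailSahiE3LroCube
import Mathlib.Tactic.Linarith
import Mathlib.Tactic.Ring
import Mathlib.Tactic.Positivity
import HarnessLib
import HarnessLib.Audit

/-!
# `NoHeavyLowerTail` (crux stmt-CriticalPhenomena-4575), Sahi programme P4: SAHI'S `C₃` / KAHN'S CONJECTURE 5 FOR THE FIRST SLOT
# `⋁ᵢ (xᵢ ∧ yᵢ)` — DNF OF WIDTH TWO, any number of dimers, every product weight on `2^κ`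

Support file (cell `prim-l12`, seat P4, generation 14; `--supports stmt-CriticalPhenomena-4575`).  No named facts, no sorries;
standard axioms; def-free.

`cert_dnf_width2_cube`: the certificate of `…SahiE3DimerOver.cert_dimer_over` (trivial base `Q = Unit`, `G = ∅`) transported to the
pattern cube `Fin n × Bool → Bool` (bit `(i, true)` = `xᵢ`, bit `(i, false)` = `yᵢ`), product weight `C · ∏_p w_p(t_p)` with
`w ≥ 0`, `C ≥ 0`, slot `U = {t | ∃ i, t (i,true) ∧ t (i,false)}`.
`latticeE3_nonneg_of_dnf_width2`: by the kernel theorem `…SahiE3PatternCertificate.latticeE3_nonneg_of_patternCertificate`,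
`0 ≤ latticeE3 μ U A B` on every finite distributive lattice with log-supermodular `μ ≥ 0`, join-primes `j : Fin n × Bool → L`,
up-sets `A, B`, slot `U = {x | ∃ i, j (i,true) ≤ x ∧ j (i,false) ≤ x}`, whenever the pattern marginal is such a product weight.
`latticeE3_nonneg_dnf_width2_prod`: the Boolean form — `μ(ω) = ∏_{u∈ω} θ_u`, `θ ≥ 0`, distinct generators `v : Fin n × Bool → κ`,
first slot `{ω | ∃ i, v (i,true) ∈ ω ∧ v (i,false) ∈ ω}`, arbitrary up-sets `A, B`.  This is the first slot class with an OR of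
arbitrarily many compound blocks; HOME prim-l12-p4/FROM-prim-l12-p4-gen14-DIMER-REDUCTION.md.
-/

namespace Summit.CriticalPhenomena.PercolationContinuityZ3.Theorems.SahiE3DnfWidthTwo

open Finset SahiE3DimerOver SahiE3LroTransport
open scoped BigOperators

/-- **The certificate of `⋁ᵢ (xᵢ ∧ yᵢ)` on the pattern cube** `Fin n × Bool → Bool` with the product weight
`ν(t) = C · ∏_p w_p(t_p)` (`w, C ≥ 0`): the slot `U = {t | ∃ i, t (i,true) ∧ t (i,false)}` is an up-set and carries a flow certificate
with exact deliveries. [this work] -/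
theorem cert_dnf_width2_cube (n : ℕ) (w : Fin n × Bool → Bool → ℝ) (hw : ∀ p c, 0 ≤ w p c) {C : ℝ} (hC : 0 ≤ C)
    (ν : (Fin n × Bool → Bool) → ℝ) (hν : ∀ t, ν t = C * ∏ p, w p (t p))
    (U : Finset (Fin n × Bool → Bool)) (hU : ∀ t, t ∈ U ↔ ∃ i, t (i, true) = true ∧ t (i, false) = true) :
    IsUpperSet (U : Set (Fin n × Bool → Bool)) ∧
    ∃ (R : (Fin n × Bool → Bool) → ℝ) (Fl : (Fin n × Bool → Bool) → (Fin n × Bool → Bool) → ℝ),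
      (∀ t ∈ U, 0 ≤ R t) ∧ (∀ t s, 0 ≤ Fl t s) ∧ (∀ t s, Fl t s ≠ 0 → s ≤ t) ∧
      (∀ t ∈ U, R t + ∑ s ∈ Uᶜ, Fl t s ≤ (∑ r, ν r) * ((∑ r, ν r) + ∑ r ∈ Uᶜ, ν r) * ν t) ∧
      (∀ s ∈ Uᶜ, ∑ t ∈ U, Fl t s = (∑ r, ν r) * (∑ r ∈ U, ν r) * ν s) ∧
      (∀ S S' : Finset (Fin n × Bool → Bool), IsUpperSet (S : Set (Fin n × Bool → Bool)) →
        IsUpperSet (S' : Set (Fin n × Bool → Bool)) →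
        (∑ r, ν r) * ((∑ t ∈ S, ν t) * (∑ t ∈ S' ∩ U, ν t) + (∑ t ∈ S', ν t) * (∑ t ∈ S ∩ U, ν t))
            - (∑ r ∈ U, ν r) * (∑ t ∈ S, ν t) * (∑ t ∈ S', ν t) ≤ ∑ t ∈ (S ∩ S') ∩ U, R t) := by
  -- the trivial base: one point, empty slot
  have hHQ : ∀ S S' : Finset Unit, IsUpperSet (S : Set Unit) → IsUpperSet (S' : Set Unit) →
      (∑ t ∈ S, (fun _ : Unit => C) t) * (∑ t ∈ S', (fun _ : Unit => C) t)
        ≤ (∑ t, (fun _ : Unit => C) t) * ∑ t ∈ S ∩ S', (fun _ : Unit => C) t :=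
    fun S S' _ _ => harris_subsingleton _ S S'
  have hG : IsUpperSet (((∅ : Finset Unit) : Finset Unit) : Set Unit) := by simp [isUpperSet_empty]
  obtain ⟨hUp, -, R, Fl, c1, c2, c3, c4, c5, c6⟩ := cert_dimer_over (Q := Unit) (νQ := fun _ => C) (fun _ => hC) hHQ ∅ hG
    (fun _ => 0) (fun _ _ => 0) (fun t ht => absurd ht (Finset.notMem_empty t)) (fun _ _ => le_rfl)
    (fun _ _ h => absurd rfl h) (fun t ht => absurd ht (Finset.notMem_empty t)) (fun s _ => by simp) (fun S S' _ _ => by simp)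
    n (fun i => w (i, true)) (fun i => w (i, false)) (fun i b => hw _ _) (fun i b => hw _ _)
    (fun x => (∏ i, w (i, true) (x.1 i).1 * w (i, false) (x.1 i).2) * C) (fun _ => rfl)
    (univ.filter fun x : (Fin n → Bool × Bool) × Unit => (∃ i, x.1 i = (true, true)) ∨ x.2 ∈ (∅ : Finset Unit))
    (fun x => by simp)
  -- transport to the cube `Fin n × Bool → Bool`
  let e : ((Fin n → Bool × Bool) × Unit) ≃o (Fin n × Bool → Bool) :=
    { toFun := fun x p => if p.2 = true then (x.1 p.1).1 else (x.1 p.1).2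
      invFun := fun t => (fun i => (t (i, true), t (i, false)), ())
      left_inv := fun x => by
        rcases x with ⟨f, u⟩
        simp only [↓reduceIte, Bool.false_eq_true, Prod.mk.eta]
      right_inv := fun t => by
        funext p; rcases p with ⟨i, b⟩; cases b <;> simp
      map_rel_iff' := by
        rintro ⟨f, u⟩ ⟨g, u'⟩
        simp only [Equiv.coe_fn_mk, Prod.mk_le_mk, Pi.le_def, Prod.forall, Bool.forall_bool, ↓reduceIte,
          Bool.false_eq_true]
        constructor
        · intro h
          exact ⟨fun i => Prod.mk_le_mk.2 ⟨(h i).2, (h i).1⟩, le_of_eq (Subsingleton.elim _ _)⟩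
        · intro h i
          exact ⟨(Prod.mk_le_mk.1 (h.1 i)).2, (Prod.mk_le_mk.1 (h.1 i)).1⟩ }
  have hes : ∀ t : Fin n × Bool → Bool, e.symm t = (fun i => (t (i, true), t (i, false)), ()) := fun t => rfl
  have hνe : ∀ t, ν t = (fun x : (Fin n → Bool × Bool) × Unit =>
      (∏ i, w (i, true) (x.1 i).1 * w (i, false) (x.1 i).2) * C) (e.symm t) := by
    intro t
    rw [hes, hν, Fintype.prod_prod_type]
    simp only [Fintype.prod_bool]
    ring
  have hUe : ∀ t, t ∈ U ↔ e.symm t ∈ (univ.filter fun x : (Fin n → Bool × Bool) × Unit =>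
      (∃ i, x.1 i = (true, true)) ∨ x.2 ∈ (∅ : Finset Unit)) := by
    intro t
    rw [hes, hU, Finset.mem_filter]
    simp only [Finset.mem_univ, true_and, Prod.mk.injEq, Finset.notMem_empty, or_false]
  obtain ⟨R', Fl', d1, d2, d3, d4, d5, d6⟩ := cert_transport e c1 c2 c3 c4 c5 c6 ν hνe U hUe
  refine ⟨?_, R', Fl', d1, d2, d3, d4, d5, d6⟩
  intro x y hxy hx
  simp only [Finset.mem_coe] at hx ⊢
  rw [hUe] at hx ⊢
  exact hUp (e.symm.monotone hxy) hx

/-! ### The lattice theorem and the Boolean form -/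

section Lattice

open Literature.Probability.LatticeModels

variable {α : Type*} [DistribLattice α] [Fintype α] [DecidableEq α] [DecidableLE α]

open scoped Classical in
/-- **Sahi's `C₃` / Kahn's Conjecture 5 for `⋁ᵢ (xᵢ ∧ yᵢ)` over join-primes.**  `L` finite distributive, `μ ≥ 0` log-supermodular,
`j : Fin n × Bool → L` join-primes, `A, B` up-sets, slot `U = {x | ∃ i, j (i,true) ≤ x ∧ j (i,false) ≤ x}`.  If the pattern marginal
`t ↦ m{x | (j p ≤ x)_p = t}` is a product weight `C · ∏_p w_p(t_p)` with `w, C ≥ 0`, then `0 ≤ latticeE3 μ U A B`. [this work] -/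
theorem latticeE3_nonneg_of_dnf_width2 {μ : α → ℝ} (hμ₀ : 0 ≤ μ)
    (hμ : ∀ x y, μ x * μ y ≤ μ (x ⊓ y) * μ (x ⊔ y)) (n : ℕ) {j : Fin n × Bool → α}
    (hj : ∀ i, SupPrime (j i)) {F : (Fin n × Bool → Bool) → Finset α}
    (hF : ∀ (t : Fin n × Bool → Bool) (x : α), x ∈ F t ↔ ∀ i, (j i ≤ x ↔ t i = true))
    {A B : Finset α} (hA : IsUpperSet (A : Set α)) (hB : IsUpperSet (B : Set α))
    (w : Fin n × Bool → Bool → ℝ) (hw : ∀ p c, 0 ≤ w p c) {C : ℝ} (hC : 0 ≤ C)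
    (hν : ∀ t, mass μ (F t) = C * ∏ p, w p (t p))
    (U' : Finset (Fin n × Bool → Bool)) (hU' : ∀ t, t ∈ U' ↔ ∃ i, t (i, true) = true ∧ t (i, false) = true) :
    0 ≤ latticeE3 μ (univ.filter fun x => (fun i => decide (j i ≤ x)) ∈ U') A B := by
  obtain ⟨-, R, Fl, h1, h2, h3, h4, h5, h6⟩ :=
    cert_dnf_width2_cube n w hw hC (fun t => C * ∏ p, w p (t p)) (fun _ => rfl) U' hU'
  refine SahiE3PatternCertificate.latticeE3_nonneg_of_patternCertificate hμ₀ hμ hj hF hA hB U'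
    (fun t => C * ∏ p, w p (t p)) (fun t => (hν t).symm) R Fl h1 h2 h3 h4 (fun s hs => (h5 s hs).ge) ?_
  intro S S' hS hS'
  have hz : ∑ s ∈ (S ∩ S') ∩ U'ᶜ, (∑ t ∈ U', Fl t s - (∑ r : Fin n × Bool → Bool, C * ∏ p, w p (r p)) *
      (∑ r ∈ U', C * ∏ p, w p (r p)) * (C * ∏ p, w p (s p))) = 0 :=
    Finset.sum_eq_zero fun s hs => by rw [h5 s (Finset.mem_inter.1 hs).2, sub_self]
  rw [hz, add_zero]
  exact h6 S S' hS hS'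

end Lattice

section Cube

open Literature.Probability.LatticeModels

variable {κ : Type*} [Fintype κ] [DecidableEq κ]

/-- **Kahn's Conjecture 5 for the first slot `⋁ᵢ (xᵢ ∧ yᵢ)`, product weights on `2^κ`.**  `μ(ω) = ∏_{u∈ω} θ_u` with `θ ≥ 0`,
distinct generators `v : Fin n × Bool → κ` (`v (i,true) = xᵢ`, `v (i,false) = yᵢ`), `A, B` arbitrary up-sets:
`0 ≤ latticeE3 μ {ω | ∃ i, v (i,true) ∈ ω ∧ v (i,false) ∈ ω} A B`. [this work] -/
theorem latticeE3_nonneg_dnf_width2_prod {θ : κ → ℝ} (hθ : ∀ u, 0 ≤ θ u) (n : ℕ)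
    {v : Fin n × Bool → κ} (hv : Function.Injective v) {A B : Finset (Finset κ)}
    (hA : IsUpperSet (A : Set (Finset κ))) (hB : IsUpperSet (B : Set (Finset κ))) :
    0 ≤ latticeE3 (fun ω : Finset κ => ∏ u ∈ ω, θ u)
      (univ.filter fun ω : Finset κ => ∃ i, v (i, true) ∈ ω ∧ v (i, false) ∈ ω) A B := by
  classical
  set F : (Fin n × Bool → Bool) → Finset (Finset κ) :=
    fun t => univ.filter fun ω : Finset κ => ∀ l, (v l ∈ ω ↔ t l = true) with hFdef
  have hF : ∀ (t : Fin n × Bool → Bool) (ω : Finset κ), ω ∈ F t ↔ ∀ l, (v l ∈ ω ↔ t l = true) := by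
    intro t ω; simp [hFdef]
  have hF' : ∀ (t : Fin n × Bool → Bool) (ω : Finset κ), ω ∈ F t ↔ ∀ l, (({v l} : Finset κ) ≤ ω ↔ t l = true) := by
    intro t ω; rw [hF]; simp
  set C : ℝ := ∑ ω ∈ ((univ : Finset (Fin n × Bool)).image v)ᶜ.powerset, ∏ u ∈ ω, θ u with hC
  have hC0 : 0 ≤ C := Finset.sum_nonneg fun ω _ => Finset.prod_nonneg fun u _ => hθ u
  set w : Fin n × Bool → Bool → ℝ := fun p c => if c = true then θ (v p) else 1 with hw
  have hw0 : ∀ p c, 0 ≤ w p c := by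
    intro p c; simp only [hw]
    split_ifs
    · exact hθ _
    · exact zero_le_one
  have hν : ∀ t, mass (fun ω : Finset κ => ∏ u ∈ ω, θ u) (F t) = C * ∏ p, w p (t p) := by
    intro t
    rw [SahiE3LroCube.mass_fib_prod θ hv hF t, ← hC, hw, mul_comm]
  obtain ⟨U', hU'⟩ : ∃ V : Finset (Fin n × Bool → Bool), ∀ t, t ∈ V ↔ ∃ i, t (i, true) = true ∧ t (i, false) = true :=
    ⟨univ.filter fun t => ∃ i, t (i, true) = true ∧ t (i, false) = true, fun t => by simp⟩
  have key := latticeE3_nonneg_of_dnf_width2 (SahiE3HitSlotProduct.prod_nonneg' hθ) (SahiE3HitSlotProduct.prod_lsm θ) n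
    (fun i => SahiE3CovHit.supPrime_singleton' (v i)) hF' hA hB w hw0 hC0 hν U' hU'
  have hslot : (univ.filter fun ω : Finset κ => (fun i => decide (({v i} : Finset κ) ≤ ω)) ∈ U') =
      univ.filter fun ω : Finset κ => ∃ i, v (i, true) ∈ ω ∧ v (i, false) ∈ ω := by
    congr 1; ext ω; simp [hU']
  rw [hslot] at key
  exact key

end Cube

end Summit.CriticalPhenomena.PercolationContinuityZ3.Theorems.SahiE3DnfWidthTwo
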